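import Mathlib.Analysis.Calculus.Deriv.MeanValue
import Mathlib.Analysis.ODE.Gronwall
import Literature.Geometry.Riemannian.RicciFlowMetricLimit
import HarnessLib

/-!
# The limit metric `ḡ` at a singular time, pointwise at points of bounded curvature
(topic `Geometry/Riemannian`)

A step of the surgery construction behind
`Literature.Geometry.Riemannian.chenZhu_ricciFlowWithSurgery` (B.-L. Chen, X.-P. Zhu,
J. Differential Geom. 74 (2006), arXiv:math/0504478, Thm. 1.1). Chen–Zhu, §4, p. 24: "We can now
assume that `Ω` is not empty. By using the local derivative estimates of Shi, we see that as
`t → T`, the solution `g_ij(·,t)` has a smooth limit `ḡ_ij(·)` on `Ω`." This file proves the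
ELEMENTARY (continuous-in-time, pointwise) half of that sentence, localising to a single point
the argument of `RicciFlowMetricLimit.lean` (Topping 2006, proof of Thm. 5.3.1, p. 47, there
under a global curvature bound): at a point `x` where the curvature of a Ricci flow of
Riemannian metrics on `[0, T)` stays frame-bounded by `K` for `t ∈ [t₁, T)` — which is what
`Ω` provides locally (`SingularTimeBoundedSet.lean` with `PinchingCurvatureBound.lean`) —

* `abs_ricci_le_of_abs_curvatureForm_le` — `|Ric_x(X,X)| ≤ n K g_x(X,X)` from the frame bound
  at `x` alone (O'Neill 1983, Lemma 3.52);
* `abs_le_abs_mul_exp_of_abs_deriv_le` (Gronwall on `[a, s]`),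
  `IsRicciFlow.metric_equivalence_at` — Topping's Lemma 5.3.2 at one point and from an
  arbitrary initial time: `e^{-2C(t−a)} g_a(X,X) ≤ g_t(X,X) ≤ e^{2C(t−a)} g_a(X,X)` under
  `|Ric_t(x)(X,X)| ≤ C g_t(x)(X,X)`;
* `IsRicciFlow.metric_bounds_at_of_abs_curvatureForm_le` — two-sided bounds relative to
  `g_{t₁}` and `|∂_t g_t(X,X)| ≤ 2nK e^{2nK(T−t₁)} g_{t₁}(X,X)` on `[t₁, T)`;
* `IsRicciFlow.exists_tendsto_metric_self_at`, **`IsRicciFlow.exists_limitMetric_at`** —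
  `g_t(x) → ḡ_x` as `t ↑ T`, `ḡ_x` a symmetric bilinear form with
  `e^{-2nK(T−t₁)} g_{t₁} ≤ ḡ_x ≤ e^{2nK(T−t₁)} g_{t₁}` on the diagonal, hence positive definite;
* `IsRicciFlow.abs_metric_sub_le_at` — the uniform-in-time Cauchy estimate
  `|g_t(X,X) − g_s(X,X)| ≤ 2nK e^{2nK(T−t₁)} g_{t₁}(X,X) (t − s)`.

Smoothness of `ḡ` (Shi's local derivative estimates) is the non-elementary half and is NOT
proved here. Everything in this file is proved; no definitions, no named facts.

## References

* B.-L. Chen, X.-P. Zhu, *Ricci flow with surgery on four-manifolds with positive isotropic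
  curvature*, J. Differential Geom. 74 (2006) 177–264 (arXiv:math/0504478), §4, p. 24.
  [ChenZhu2006]
* P. Topping, *Lectures on the Ricci flow*, LMS Lecture Note Series 325 (2006), §5.3,
  Lemma 5.3.2 and proof of Thm. 5.3.1 (p. 47). [Topping2006]
* B. O'Neill, *Semi-Riemannian geometry*, Academic Press 1983, Ch. 3, Lemma 3.52. [ONeill1983]
-/

noncomputable section

open Bundle Set Filter Real Module
open scoped Manifold ContDiff Topology

namespace Literature.Geometry.Riemannian

open Lorentzian Lorentzian.PseudoRiemannianMetric

variable {E : Type*} [NormedAddCommGroup E] [NormedSpace ℝ E] [FiniteDimensional ℝ E]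
  [CompleteSpace E] {H : Type*} [TopologicalSpace H] {I : ModelWithCorners ℝ E H}
  {M : Type*} [TopologicalSpace M] [ChartedSpace H M] [IsManifold I ∞ M]

/-! ### A pointwise curvature bound bounds the Ricci tensor at the point -/

omit [CompleteSpace E] in
/-- **`|Rm_x| ≤ K` gives `|Ric_x(X,X)| ≤ n K g_x(X,X)`** — the pointwise form of
`CurvatureBoundedBy.abs_ricci_le` (O'Neill 1983, Lemma 3.52: `Ric(X,X) = Σ_m Rm(b_m, X, X, b_m)`
in a `g_x`-orthonormal basis). [cite: ONeill1983, Ch. 3, Lemma 3.52] -/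
theorem abs_ricci_le_of_abs_curvatureForm_le {n : ℕ∞ω}
    {g : PseudoRiemannianMetric I n E (TangentSpace I : M → Type _)}
    {cov : CovariantDerivative I E (TangentSpace I : M → Type _)} {K : ℝ} (hg : g.IsRiemannian)
    (x : M) (hK : ∀ X Y Z W : TangentSpace I x, g.val x X X ≤ 1 → g.val x Y Y ≤ 1 →
      g.val x Z Z ≤ 1 → g.val x W W ≤ 1 → |g.curvatureForm cov x X Y Z W| ≤ K)
    (X : TangentSpace I x) : |cov.ricci x X X| ≤ finrank ℝ E * K * g.val x X X := by
  -- the unit case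
  have hunit : ∀ Y : TangentSpace I x, g.val x Y Y ≤ 1 → |cov.ricci x Y Y| ≤ finrank ℝ E * K := by
    intro Y hY
    obtain ⟨b, hb⟩ := g.exists_basis_isOrthonormalFrame (x := x) (hg x) rfl
    rw [g.ricci_eq_sum_of_isOrthonormalFrame b hb cov Y Y]
    refine (Finset.abs_sum_le_sum_abs _ _).trans ?_
    calc ∑ m, |g.curvatureForm cov x (b m) Y Y (b m)|
        ≤ ∑ _m : Fin (finrank ℝ E), K :=
          Finset.sum_le_sum fun m _ ↦ hK (b m) Y Y (b m) (hb.1 m).le hY hY (hb.1 m).le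
      _ = finrank ℝ E * K := by simp
  by_cases hX : X = 0
  · subst hX; simp
  set c : ℝ := g.val x X X with hc
  have hcpos : 0 < c := hg x X hX
  set a : ℝ := Real.sqrt c with ha
  have hapos : 0 < a := Real.sqrt_pos.2 hcpos
  have haa : a * a = c := Real.mul_self_sqrt hcpos.le
  set Y : TangentSpace I x := a⁻¹ • X with hY
  have hXY : X = a • Y := by
    rw [hY, smul_smul, mul_inv_cancel₀ hapos.ne', one_smul]
  have hYY : g.val x Y Y = 1 := by
    have ha0 : a ≠ 0 := hapos.ne'
    simp only [hY, map_smul, FunLike.coe_smul, Pi.smul_apply, smul_eq_mul]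
    rw [← hc, ← haa]
    field_simp
  have hRic : cov.ricci x X X = c * cov.ricci x Y Y := by
    rw [hXY]
    simp only [map_smul, LinearMap.smul_apply, smul_eq_mul]
    rw [← haa]
    ring
  rw [hRic, abs_mul, abs_of_pos hcpos]
  calc c * |cov.ricci x Y Y| ≤ c * (finrank ℝ E * K) := by gcongr; exact hunit Y hYY.le
    _ = finrank ℝ E * K * c := by ring

/-! ### Gronwall on `[a, s]` and pointwise metric equivalence from a time `t₁` -/

/-- Gronwall for a scalar on `[a, s]`: `|φ'| ≤ K |φ|` within `[a, s]` gives
`|φ t| ≤ |φ a| e^{K (t - a)}`. [folklore] -/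
theorem abs_le_abs_mul_exp_of_abs_deriv_le {φ φ' : ℝ → ℝ} {a s K : ℝ}
    (hφ : ∀ t ∈ Icc a s, HasDerivWithinAt φ (φ' t) (Icc a s) t)
    (hbound : ∀ t ∈ Icc a s, |φ' t| ≤ K * |φ t|) :
    ∀ t ∈ Icc a s, |φ t| ≤ |φ a| * exp (K * (t - a)) := by
  have hcont : ContinuousOn φ (Icc a s) := fun t ht ↦ (hφ t ht).continuousWithinAt
  have hder : ∀ t ∈ Ico a s, HasDerivWithinAt φ (φ' t) (Ici t) t := by
    intro t ht
    refine (hφ t (Ico_subset_Icc_self ht)).mono_of_mem_nhdsWithin ?_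
    exact Filter.mem_of_superset (Icc_mem_nhdsGE ht.2) (Icc_subset_Icc ht.1 le_rfl)
  have := norm_le_gronwallBound_of_norm_deriv_right_le (f := φ) (f' := φ') (δ := |φ a|) (K := K)
    (ε := 0) (a := a) (b := s) hcont hder (by simp) (fun t ht ↦ by
      simpa [Real.norm_eq_abs] using hbound t (Ico_subset_Icc_self ht))
  intro t ht
  have h := this t ht
  rwa [gronwallBound_ε0, Real.norm_eq_abs] at h

variable {g : ℝ → PseudoRiemannianMetric I ∞ E (TangentSpace I : M → Type _)}
  {cov : ℝ → CovariantDerivative I E (TangentSpace I : M → Type _)}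

/-- **Pointwise metric equivalence under a Ricci bound at one point** (Topping 2006,
Lemma 5.3.2, read at a single point and from an arbitrary initial time): along a Ricci flow of
Riemannian metrics on `[a, s]`, if `|Ric_t(x)(X, X)| ≤ C g_t(x)(X, X)` for `t ∈ [a, s]` at the
fixed `(x, X)`, then `e^{-2C(t−a)} g_a(X,X) ≤ g_t(X,X) ≤ e^{2C(t−a)} g_a(X,X)` on `[a, s]`.
[cite: Topping2006, Lemma 5.3.2] -/
theorem IsRicciFlow.metric_equivalence_at {a s C : ℝ} (h : IsRicciFlow g cov (Icc a s))
    (hR : ∀ t ∈ Icc a s, (g t).IsRiemannian) (x : M) (X : TangentSpace I x)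
    (hRic : ∀ t ∈ Icc a s, |(cov t).ricci x X X| ≤ C * (g t).val x X X)
    (t : ℝ) (ht : t ∈ Icc a s) :
    exp (-(2 * C * (t - a))) * (g a).val x X X ≤ (g t).val x X X ∧
      (g t).val x X X ≤ exp (2 * C * (t - a)) * (g a).val x X X := by
  by_cases hX : X = 0
  · subst hX; simp
  have has : a ∈ Icc a s := ⟨le_rfl, ht.1.trans ht.2⟩
  set φ : ℝ → ℝ := fun τ ↦ (g τ).val x X X with hφdef
  have hφpos : ∀ τ ∈ Icc a s, 0 < φ τ := fun τ hτ ↦ hR τ hτ x X hX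
  have hφder : ∀ τ ∈ Icc a s, HasDerivWithinAt φ (-2 * (cov τ).ricci x X X) (Icc a s) τ :=
    fun τ hτ ↦ h.hasDerivWithinAt τ hτ x X X
  have hbound : ∀ τ ∈ Icc a s, |(-2 * (cov τ).ricci x X X)| ≤ (2 * C) * |φ τ| := by
    intro τ hτ
    rw [abs_of_pos (hφpos τ hτ), abs_mul, abs_neg, abs_two]
    have := hRic τ hτ
    nlinarith
  -- upper bound
  have hup := abs_le_abs_mul_exp_of_abs_deriv_le hφder hbound t ht
  rw [abs_of_pos (hφpos t ht), abs_of_pos (hφpos a has)] at hup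
  refine ⟨?_, by simpa [hφdef, mul_comm] using hup⟩
  -- lower bound via `ψ = 1/φ`
  set ψ : ℝ → ℝ := fun τ ↦ (φ τ)⁻¹ with hψdef
  have hψder : ∀ τ ∈ Icc a s,
      HasDerivWithinAt ψ (-(-2 * (cov τ).ricci x X X) / (φ τ) ^ 2) (Icc a s) τ :=
    fun τ hτ ↦ (hφder τ hτ).inv (hφpos τ hτ).ne'
  have hψbound : ∀ τ ∈ Icc a s,
      |(-(-2 * (cov τ).ricci x X X) / (φ τ) ^ 2)| ≤ (2 * C) * |ψ τ| := by
    intro τ hτ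
    have hφτ := hφpos τ hτ
    rw [abs_div, abs_neg, abs_mul, abs_neg, abs_two, abs_of_pos (pow_pos hφτ 2), hψdef]
    simp only
    rw [abs_of_pos (inv_pos.mpr hφτ), div_le_iff₀ (pow_pos hφτ 2)]
    have hK : |(cov τ).ricci x X X| ≤ C * φ τ := hRic τ hτ
    calc 2 * |(cov τ).ricci x X X| ≤ 2 * (C * φ τ) := by linarith
      _ = 2 * C * (φ τ)⁻¹ * φ τ ^ 2 := by field_simp
  have hlow := abs_le_abs_mul_exp_of_abs_deriv_le hψder hψbound t ht
  rw [hψdef] at hlow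
  simp only at hlow
  rw [abs_of_pos (inv_pos.mpr (hφpos t ht)), abs_of_pos (inv_pos.mpr (hφpos a has))] at hlow
  have hφt := hφpos t ht
  have hφa := hφpos a has
  rw [Real.exp_neg]
  rw [inv_le_comm₀ hφt (by positivity)] at hlow
  calc (exp (2 * C * (t - a)))⁻¹ * (g a).val x X X = ((φ a)⁻¹ * exp (2 * C * (t - a)))⁻¹ := by
        rw [mul_inv, inv_inv, mul_comm]
    _ ≤ φ t := hlow

/-! ### The limit metric at a point of bounded curvature -/

variable {T : ℝ}

/-- **Pointwise bounds from a curvature bound near `T` at one point.** Along a Ricci flow of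
Riemannian metrics on `[0, T)`, if at the point `x` the curvature is frame-bounded by `K` for
all `t ∈ [t₁, T)` (`t₁ ∈ [0, T)`), then with `L = n K`: for `t ∈ [t₁, T)` and every `X`,
`e^{-2L(t−t₁)} g_{t₁}(X,X) ≤ g_t(X,X) ≤ e^{2L(t−t₁)} g_{t₁}(X,X)` and
`|∂_t g_t(X,X)| = 2|Ric_t(X,X)| ≤ 2L e^{2L(T−t₁)} g_{t₁}(X,X)` (Topping 2006, Lemma 5.3.2 and
p. 47, localised). [cite: Topping2006, §5.3, Lemma 5.3.2 and proof of Thm. 5.3.1 (p. 47)] -/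
theorem IsRicciFlow.metric_bounds_at_of_abs_curvatureForm_le (h : IsRicciFlow g cov (Ico 0 T))
    (hR : ∀ t ∈ Ico 0 T, (g t).IsRiemannian) {x : M} {K t₁ : ℝ} (ht₁ : t₁ ∈ Ico 0 T)
    (hK : ∀ t ∈ Ico t₁ T, ∀ X Y Z W : TangentSpace I x, (g t).val x X X ≤ 1 →
      (g t).val x Y Y ≤ 1 → (g t).val x Z Z ≤ 1 → (g t).val x W W ≤ 1 →
        |(g t).curvatureForm (cov t) x X Y Z W| ≤ K)
    (t : ℝ) (ht : t ∈ Ico t₁ T) (X : TangentSpace I x) :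
    (exp (-(2 * (finrank ℝ E * K) * (t - t₁))) * (g t₁).val x X X ≤ (g t).val x X X ∧
      (g t).val x X X ≤ exp (2 * (finrank ℝ E * K) * (t - t₁)) * (g t₁).val x X X) ∧
      |(-2 * (cov t).ricci x X X)| ≤
        2 * (finrank ℝ E * K) * exp (2 * (finrank ℝ E * K) * (T - t₁)) * (g t₁).val x X X := by
  set L : ℝ := finrank ℝ E * K with hL
  have hsub : Icc t₁ t ⊆ Ico 0 T := fun s hs ↦ ⟨ht₁.1.trans hs.1, hs.2.trans_lt ht.2⟩
  have hsub' : Icc t₁ t ⊆ Ico t₁ T := fun s hs ↦ ⟨hs.1, hs.2.trans_lt ht.2⟩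
  have hRic : ∀ s ∈ Icc t₁ t, |(cov s).ricci x X X| ≤ L * (g s).val x X X := fun s hs ↦
    abs_ricci_le_of_abs_curvatureForm_le (hR s (hsub hs)) x (hK s (hsub' hs)) X
  have heq := (h.mono hsub).metric_equivalence_at (fun s hs ↦ hR s (hsub hs)) x X hRic t
    ⟨ht.1, le_rfl⟩
  refine ⟨heq, ?_⟩
  -- the derivative bound
  have hK0 : 0 ≤ K := (abs_nonneg _).trans (hK t ht 0 0 0 0 (by simp) (by simp) (by simp) (by simp))
  have hL0 : 0 ≤ L := mul_nonneg (Nat.cast_nonneg _) hK0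
  have hg1 : 0 ≤ (g t₁).val x X X := by
    by_cases hX : X = 0
    · subst hX; simp
    · exact (hR t₁ ht₁ x X hX).le
  have hRict := hRic t ⟨ht.1, le_rfl⟩
  have hexp : exp (2 * L * (t - t₁)) ≤ exp (2 * L * (T - t₁)) :=
    exp_le_exp.2 (by nlinarith [ht.2.le, ht.1])
  rw [abs_mul, abs_neg, abs_two]
  calc 2 * |(cov t).ricci x X X| ≤ 2 * (L * (g t).val x X X) := by linarith
    _ ≤ 2 * (L * (exp (2 * L * (t - t₁)) * (g t₁).val x X X)) := by gcongr; exact heq.2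
    _ ≤ 2 * (L * (exp (2 * L * (T - t₁)) * (g t₁).val x X X)) := by gcongr
    _ = 2 * L * exp (2 * L * (T - t₁)) * (g t₁).val x X X := by ring

/-- **`g_t(x)(X,X)` converges as `t ↑ T` at a point of bounded curvature** (Topping 2006, p. 47,
localised; Chen–Zhu 2006, §4, p. 24: "as `t → T`, the solution `g_ij(·,t)` has a … limit
`ḡ_ij(·)` on `Ω`" — the pointwise, `C⁰`-in-time part): with `B` the derivative bound of
`metric_bounds_at_of_abs_curvatureForm_le`, `t ↦ g_t(X,X) + Bt` is monotone and bounded on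
`[t₁, T)`. [cite: Topping2006, §5.3, proof of Thm. 5.3.1 (p. 47)] [cite: ChenZhu2006, §4, p. 24] -/
theorem IsRicciFlow.exists_tendsto_metric_self_at (h : IsRicciFlow g cov (Ico 0 T))
    (hR : ∀ t ∈ Ico 0 T, (g t).IsRiemannian) {x : M} {K t₁ : ℝ} (ht₁ : t₁ ∈ Ico 0 T)
    (hK : ∀ t ∈ Ico t₁ T, ∀ X Y Z W : TangentSpace I x, (g t).val x X X ≤ 1 →
      (g t).val x Y Y ≤ 1 → (g t).val x Z Z ≤ 1 → (g t).val x W W ≤ 1 →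
        |(g t).curvatureForm (cov t) x X Y Z W| ≤ K)
    (X : TangentSpace I x) :
    ∃ ℓ : ℝ, Tendsto (fun t ↦ (g t).val x X X) (𝓝[<] T) (𝓝 ℓ) := by
  set L : ℝ := finrank ℝ E * K with hL
  set B : ℝ := 2 * L * exp (2 * L * (T - t₁)) * (g t₁).val x X X with hB
  set φ : ℝ → ℝ := fun t ↦ (g t).val x X X with hφ
  set ψ : ℝ → ℝ := fun t ↦ φ t + B * t with hψ
  have hT : t₁ < T := ht₁.2
  have hK0 : 0 ≤ K :=
    (abs_nonneg _).trans (hK t₁ ⟨le_rfl, hT⟩ 0 0 0 0 (by simp) (by simp) (by simp) (by simp))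
  have hL0 : 0 ≤ L := mul_nonneg (Nat.cast_nonneg _) hK0
  have hg1 : 0 ≤ (g t₁).val x X X := by
    by_cases hX : X = 0
    · subst hX; simp
    · exact (hR t₁ ht₁ x X hX).le
  have hB0 : 0 ≤ B := by positivity
  have hsub : Ico t₁ T ⊆ Ico 0 T := fun s hs ↦ ⟨ht₁.1.trans hs.1, hs.2⟩
  -- derivative of `ψ` within `[t₁, T)` and its sign
  have hder : ∀ t ∈ Ico t₁ T, HasDerivWithinAt ψ (-2 * (cov t).ricci x X X + B) (Ico t₁ T) t :=
    fun t ht ↦ ((h.hasDerivWithinAt t (hsub ht) x X X).mono hsub).add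
      (by simpa using (hasDerivWithinAt_id t (Ico t₁ T)).const_mul B)
  have hnonneg : ∀ t ∈ Ico t₁ T, 0 ≤ -2 * (cov t).ricci x X X + B := by
    intro t ht
    have := (h.metric_bounds_at_of_abs_curvatureForm_le hR ht₁ hK t ht X).2
    rw [← hL, ← hB] at this
    linarith [neg_abs_le (-2 * (cov t).ricci x X X)]
  -- `ψ` is monotone on `[t₁, T)`
  have hmono : MonotoneOn ψ (Ico t₁ T) := by
    refine monotoneOn_of_hasDerivWithinAt_nonneg (f' := fun t ↦ -2 * (cov t).ricci x X X + B)
      (convex_Ico t₁ T) (fun t ht ↦ (hder t ht).continuousWithinAt) ?_ ?_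
    · intro t ht
      rw [interior_Ico] at ht ⊢
      exact (hder t (Ioo_subset_Ico_self ht)).mono Ioo_subset_Ico_self
    · intro t ht
      rw [interior_Ico] at ht
      exact hnonneg t (Ioo_subset_Ico_self ht)
  -- and bounded above
  have hbdd : BddAbove (ψ '' Ioo t₁ T) := by
    refine ⟨exp (2 * L * (T - t₁)) * (g t₁).val x X X + B * T, ?_⟩
    rintro _ ⟨t, ht, rfl⟩
    have hup := (h.metric_bounds_at_of_abs_curvatureForm_le hR ht₁ hK t
      (Ioo_subset_Ico_self ht) X).1.2
    rw [← hL] at hup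
    have hexp : exp (2 * L * (t - t₁)) ≤ exp (2 * L * (T - t₁)) :=
      exp_le_exp.2 (by nlinarith [ht.2.le, ht.1.le])
    have hBt : B * t ≤ B * T := by nlinarith [ht.2.le]
    simp only [hψ, hφ]
    nlinarith [mul_le_mul_of_nonneg_right hexp hg1]
  have hlim := (hmono.mono Ioo_subset_Ico_self).tendsto_nhdsWithin_Ioo_left
    ⟨(t₁ + T) / 2, by constructor <;> linarith⟩ hbdd
  -- subtract the linear part again
  have hlin : Tendsto (fun t : ℝ ↦ B * t) (𝓝[<] T) (𝓝 (B * T)) :=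
    ((continuous_const.mul continuous_id).tendsto T).mono_left nhdsWithin_le_nhds
  refine ⟨sSup (ψ '' Ioo t₁ T) - B * T, ?_⟩
  have := hlim.sub hlin
  simpa [hψ] using this

/-- **The limit metric `ḡ(x)` at a point of bounded curvature** (Chen–Zhu 2006, §4, p. 24:
"the solution `g_ij(·,t)` has a … limit `ḡ_ij(·)` on `Ω`"; Topping 2006, p. 47: "the `g(T)`
which has been added will be a metric. (In particular, it will be positive definite.)" — the
pointwise, continuous-in-time part; smoothness of `ḡ` needs the local derivative estimates of
Shi, not proved here). Along a Ricci flow of Riemannian metrics on `[0, T)`, if at `x` the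
curvature is frame-bounded by `K` for `t ∈ [t₁, T)`, there is a symmetric bilinear form `ḡ_x`
on `T_x M` with `g_t(x)(X, Y) → ḡ_x(X, Y)` as `t ↑ T`,
`e^{-2nK(T−t₁)} g_{t₁}(X,X) ≤ ḡ_x(X,X) ≤ e^{2nK(T−t₁)} g_{t₁}(X,X)`, in particular `ḡ_x` is
positive definite. [cite: ChenZhu2006, §4, p. 24] [cite: Topping2006, §5.3, proof of Thm. 5.3.1 (p. 47)] -/
theorem IsRicciFlow.exists_limitMetric_at (h : IsRicciFlow g cov (Ico 0 T))
    (hR : ∀ t ∈ Ico 0 T, (g t).IsRiemannian) {x : M} {K t₁ : ℝ} (ht₁ : t₁ ∈ Ico 0 T)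
    (hK : ∀ t ∈ Ico t₁ T, ∀ X Y Z W : TangentSpace I x, (g t).val x X X ≤ 1 →
      (g t).val x Y Y ≤ 1 → (g t).val x Z Z ≤ 1 → (g t).val x W W ≤ 1 →
        |(g t).curvatureForm (cov t) x X Y Z W| ≤ K) :
    ∃ gT : LinearMap.BilinForm ℝ (TangentSpace I x),
      (∀ X Y, Tendsto (fun t ↦ (g t).val x X Y) (𝓝[<] T) (𝓝 (gT X Y))) ∧
      (∀ X Y, gT X Y = gT Y X) ∧
      (∀ X, exp (-(2 * (finrank ℝ E * K) * (T - t₁))) * (g t₁).val x X X ≤ gT X X ∧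
        gT X X ≤ exp (2 * (finrank ℝ E * K) * (T - t₁)) * (g t₁).val x X X) ∧
      ∀ X, X ≠ 0 → 0 < gT X X := by
  set L : ℝ := finrank ℝ E * K with hL
  have hT : t₁ < T := ht₁.2
  -- the candidate: pointwise limits
  set f : TangentSpace I x → TangentSpace I x → ℝ :=
    fun X Y ↦ limUnder (𝓝[<] T) (fun t ↦ (g t).val x X Y) with hf
  -- limits exist, by polarisation from the diagonal case
  have hconv : ∀ X Y, Tendsto (fun t ↦ (g t).val x X Y) (𝓝[<] T) (𝓝 (f X Y)) := by
    intro X Y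
    obtain ⟨a, ha⟩ := h.exists_tendsto_metric_self_at hR ht₁ hK (X + Y)
    obtain ⟨b, hb⟩ := h.exists_tendsto_metric_self_at hR ht₁ hK X
    obtain ⟨c, hc⟩ := h.exists_tendsto_metric_self_at hR ht₁ hK Y
    have hpol : (fun t ↦ (g t).val x X Y) =
        fun t ↦ ((g t).val x (X + Y) (X + Y) - (g t).val x X X - (g t).val x Y Y) / 2 := by
      funext t
      simp only [map_add, _root_.add_apply, (g t).symm x Y X]
      ring
    refine tendsto_nhds_limUnder ⟨(a - b - c) / 2, ?_⟩
    rw [hpol]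
    exact ((ha.sub hb).sub hc).div_const 2
  have hsymm : ∀ X Y, f X Y = f Y X := fun X Y ↦ by
    have : (fun t ↦ (g t).val x X Y) = fun t ↦ (g t).val x Y X := funext fun t ↦ (g t).symm x X Y
    simp only [hf]
    rw [this]
  have hadd : ∀ X X' Y, f (X + X') Y = f X Y + f X' Y := fun X X' Y ↦
    tendsto_nhds_unique (hconv (X + X') Y)
      (by simpa only [map_add, _root_.add_apply] using (hconv X Y).add (hconv X' Y))
  have hsmul : ∀ (c : ℝ) X Y, f (c • X) Y = c * f X Y := fun c X Y ↦
    tendsto_nhds_unique (hconv (c • X) Y)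
      (by simpa only [map_smul, FunLike.coe_smul, Pi.smul_apply, smul_eq_mul]
        using (hconv X Y).const_mul c)
  let gT : LinearMap.BilinForm ℝ (TangentSpace I x) :=
    LinearMap.mk₂ ℝ f hadd hsmul
      (fun X Y Y' ↦ by rw [hsymm, hadd, hsymm Y, hsymm Y'])
      (fun c X Y ↦ by rw [smul_eq_mul, hsymm, hsmul, hsymm Y])
  have hgT : ∀ X Y, gT X Y = f X Y := fun X Y ↦ rfl
  -- two-sided bounds pass to the limit
  have hbounds : ∀ X, exp (-(2 * L * (T - t₁))) * (g t₁).val x X X ≤ f X X ∧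
      f X X ≤ exp (2 * L * (T - t₁)) * (g t₁).val x X X := by
    intro X
    have hg1 : 0 ≤ (g t₁).val x X X := by
      by_cases hX : X = 0
      · subst hX; simp
      · exact (hR t₁ ht₁ x X hX).le
    have hev : ∀ᶠ t in 𝓝[<] T, t ∈ Ioo t₁ T := Ioo_mem_nhdsLT hT
    constructor
    · refine ge_of_tendsto (hconv X X) (hev.mono fun t ht ↦ ?_)
      have hlow := (h.metric_bounds_at_of_abs_curvatureForm_le hR ht₁ hK t
        (Ioo_subset_Ico_self ht) X).1.1
      rw [← hL] at hlow
      have hexp : exp (-(2 * L * (T - t₁))) ≤ exp (-(2 * L * (t - t₁))) := by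
        refine exp_le_exp.2 ?_
        have hK0 : 0 ≤ K := (abs_nonneg _).trans
          (hK t (Ioo_subset_Ico_self ht) 0 0 0 0 (by simp) (by simp) (by simp) (by simp))
        have hL0 : 0 ≤ L := mul_nonneg (Nat.cast_nonneg _) hK0
        nlinarith [ht.2.le, ht.1.le]
      exact (mul_le_mul_of_nonneg_right hexp hg1).trans hlow
    · refine le_of_tendsto (hconv X X) (hev.mono fun t ht ↦ ?_)
      have hup := (h.metric_bounds_at_of_abs_curvatureForm_le hR ht₁ hK t
        (Ioo_subset_Ico_self ht) X).1.2
      rw [← hL] at hup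
      have hexp : exp (2 * L * (t - t₁)) ≤ exp (2 * L * (T - t₁)) := by
        refine exp_le_exp.2 ?_
        have hK0 : 0 ≤ K := (abs_nonneg _).trans
          (hK t (Ioo_subset_Ico_self ht) 0 0 0 0 (by simp) (by simp) (by simp) (by simp))
        have hL0 : 0 ≤ L := mul_nonneg (Nat.cast_nonneg _) hK0
        nlinarith [ht.2.le, ht.1.le]
      exact hup.trans (mul_le_mul_of_nonneg_right hexp hg1)
  refine ⟨gT, fun X Y ↦ hgT X Y ▸ hconv X Y, fun X Y ↦ (hgT X Y).trans ((hsymm X Y).trans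
    (hgT Y X).symm), fun X ↦ ⟨(hgT X X).symm ▸ (hbounds X).1, (hgT X X).symm ▸ (hbounds X).2⟩,
    fun X hX ↦ ?_⟩
  rw [hgT]
  exact lt_of_lt_of_le (mul_pos (exp_pos _) (hR t₁ ht₁ x X hX)) (hbounds X).1

/-- **Uniform Cauchy estimate in time** at a point of bounded curvature: for
`t₁ ≤ s ≤ t < T`, `|g_t(X,X) − g_s(X,X)| ≤ 2 n K e^{2nK(T−t₁)} g_{t₁}(X,X) · (t − s)` (mean
value inequality with the derivative bound; this is the estimate that makes the convergence
to `ḡ` uniform on sets where `K` and `g_{t₁}` are uniform).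
[cite: Topping2006, §5.3, proof of Thm. 5.3.1 (p. 47)] -/
theorem IsRicciFlow.abs_metric_sub_le_at (h : IsRicciFlow g cov (Ico 0 T))
    (hR : ∀ t ∈ Ico 0 T, (g t).IsRiemannian) {x : M} {K t₁ : ℝ} (ht₁ : t₁ ∈ Ico 0 T)
    (hK : ∀ t ∈ Ico t₁ T, ∀ X Y Z W : TangentSpace I x, (g t).val x X X ≤ 1 →
      (g t).val x Y Y ≤ 1 → (g t).val x Z Z ≤ 1 → (g t).val x W W ≤ 1 →
        |(g t).curvatureForm (cov t) x X Y Z W| ≤ K)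
    (X : TangentSpace I x) {s t : ℝ} (hs : t₁ ≤ s) (hst : s ≤ t) (ht : t < T) :
    |(g t).val x X X - (g s).val x X X| ≤
      2 * (finrank ℝ E * K) * exp (2 * (finrank ℝ E * K) * (T - t₁)) * (g t₁).val x X X *
        (t - s) := by
  set B : ℝ := 2 * (finrank ℝ E * K) * exp (2 * (finrank ℝ E * K) * (T - t₁)) *
    (g t₁).val x X X with hB
  have hsub : Icc s t ⊆ Ico 0 T := fun u hu ↦ ⟨ht₁.1.trans (hs.trans hu.1), hu.2.trans_lt ht⟩
  have hder : ∀ u ∈ Icc s t, HasDerivWithinAt (fun τ ↦ (g τ).val x X X)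
      (-2 * (cov u).ricci x X X) (Icc s t) u := fun u hu ↦
    (h.hasDerivWithinAt u (hsub hu) x X X).mono hsub
  have hbound : ∀ u ∈ Icc s t, ‖-2 * (cov u).ricci x X X‖ ≤ B := fun u hu ↦ by
    rw [Real.norm_eq_abs]
    exact (h.metric_bounds_at_of_abs_curvatureForm_le hR ht₁ hK u
      ⟨hs.trans hu.1, hu.2.trans_lt ht⟩ X).2
  have hmv := (convex_Icc s t).norm_image_sub_le_of_norm_hasDerivWithin_le hder hbound
    (left_mem_Icc.2 hst) (right_mem_Icc.2 hst)
  rw [Real.norm_eq_abs, Real.norm_eq_abs, abs_of_nonneg (sub_nonneg.2 hst)] at hmv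
  exact hmv

end Literature.Geometry.Riemannian

end
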